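import Mathlib.LinearAlgebra.FiniteDimensional.Lemmas
import Mathlib.LinearAlgebra.Matrix.ToLin
import HarnessLib

/-!
# ω-census family (a): a rank–nullity bookkeeping lemma for the δ-law (kernel split along a block family)

Cell `pub-omega` (unit `pub-omega-tensor`, gen 34), topic `Summits/MatrixMultiplication/OmegaCensus` (sub-folder
`SmallFormats`). Framing (verbatim): lottery ticket; floor = certified bounds/negative ranges. HONEST FRAMING: pure linear
algebra, no content of its own. For a subspace `K`, linear maps `π_i` and a set `S` of indices: if every `W ∈ K` killed by all
`π_i`, `i ∈ S`, lies in `E`, then `dim K ≤ dim (K ⊓ E) + Σ_{i ∈ S} dim π_i(K)` (`finrank_le_inf_add_sum`). Used by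
`InvertiblePointDeltaLawTwo` to charge the free columns of a saturated point against the common kernel. Nothing on `ω`.
-/

namespace Summit.MatrixMultiplication.OmegaCensus.SmallFormats.DeltaLaw

open Module

/-- **Kernel split.** `dim K ≤ dim (K ⊓ E) + Σ_{i : S i} dim (K.map (π i))` whenever the joint kernel of the `π_i`
(`S i`) inside `K` lies in `E`. -/
theorem finrank_le_inf_add_sum {k : Type*} [Field k] {V : Type*} [AddCommGroup V] [Module k V]
    [FiniteDimensional k V] {I : Type*} [Fintype I] {P : I → Type*} [∀ i, AddCommGroup (P i)]
    [∀ i, Module k (P i)] [∀ i, FiniteDimensional k (P i)] (K : Submodule k V) (π : ∀ i, V →ₗ[k] P i)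
    (S : I → Prop) [DecidablePred S] (E : Submodule k V)
    (hE : ∀ W ∈ K, (∀ i, S i → π i W = 0) → W ∈ E) :
    finrank k K ≤ finrank k ↥(K ⊓ E) + ∑ i : {i // S i}, finrank k ↥(K.map (π (i : I))) := by
  let ψ : K →ₗ[k] (∀ i : {i // S i}, ↥(K.map (π (i : I)))) :=
    LinearMap.pi fun i => LinearMap.codRestrict (K.map (π (i : I))) ((π (i : I)).domRestrict K)
      fun W => Submodule.mem_map_of_mem W.2
  have hker : ∀ W : K, ψ W = 0 → (W : V) ∈ E := by
    intro W hW
    refine hE W W.2 fun i hi => ?_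
    have := congr_fun hW ⟨i, hi⟩
    rw [Pi.zero_apply] at this
    have h' := congrArg (fun x : ↥(K.map (π i)) => (x : P i)) this
    simpa [ψ] using h'
  let θ : LinearMap.ker ψ →ₗ[k] ↥(K ⊓ E) :=
    { toFun := fun W => ⟨(W : K), (W : K).2, hker W (LinearMap.mem_ker.mp W.2)⟩
      map_add' := fun _ _ => rfl
      map_smul' := fun _ _ => rfl }
  have hθ : Function.Injective θ := by
    intro W W' h
    apply Subtype.ext; apply Subtype.ext
    exact congrArg (fun x : ↥(K ⊓ E) => (x : V)) h
  have hkerle : finrank k (LinearMap.ker ψ) ≤ finrank k ↥(K ⊓ E) := LinearMap.finrank_le_finrank_of_injective hθ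
  have hrange : finrank k (LinearMap.range ψ) ≤ ∑ i : {i // S i}, finrank k ↥(K.map (π (i : I))) := by
    calc finrank k (LinearMap.range ψ) ≤ finrank k (∀ i : {i // S i}, ↥(K.map (π (i : I)))) :=
          Submodule.finrank_le _
      _ = ∑ i : {i // S i}, finrank k ↥(K.map (π (i : I))) := Module.finrank_pi_fintype k
  have hrn := LinearMap.finrank_range_add_finrank_ker ψ
  omega

end Summit.MatrixMultiplication.OmegaCensus.SmallFormats.DeltaLaw
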